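/-
Copyright: the b2b-balaban T⁴-continuum CRUX team, row NE7b OWNER lineage `t4-ne7b-p1` (gen 120). Project licence.
-/
import Summits.QuantumFields.BalabanUV.T4Continuum.Spine.NE7b.SupTorusDirichletFormCoercive
import Literature.MathematicalPhysics.QuantumFieldTheory.Balaban1983to89.B4Sect5Torus

/-!
# THE `ℓ¹` CIRCULAR DISTANCE ON THE TORI OF THE ROAD: `ρ_s(x, y) = Σ_i |valMinAbs (x i − y i)|` on `Site d s = (ℤ∕s)^d` is a
# pseudo-distance, BOND-LIPSCHITZ (`|ρ(x+ê_μ, y) − ρ(x, y)| ≤ 1` — (131)'s observable letter), compares FINE AND COARSE tori blockwise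
# (`(n+1)ρ_s(y,y′) − dn ≤ ρ_{(n+1)s}(x,x′) ≤ (n+1)ρ_s(y,y′) + dn` for `x, x′` in the torus blocks `y, y′`), has lattice sums
# `Σ_{y′} e^{−αρ_s(y,y′)} ≤ (2∕(1 − e^{−α}))^d` UNIFORMLY IN THE PERIOD, and therefore carries B4's Sect. 5 Theorem BY NAME: a coercive,
# exponentially local operator on ANY torus `(ℤ∕s)^d` has an exponentially local inverse with period-free constants
# (row NE7b, node U5c; `B4Sect5Torus.sect5Uniform_holds` + Mathlib's `ZMod.valMinAbs` BY NAME; [folklore])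

Cell `pub-balaban`, sub-cell `t4`, spine estimate NE7b (`T4WeightBudget.RelWeightBound`; the cell's OWN estimate — NOT PRINTED in
[Bałaban 1983–89], NOT PROVED).  Crux-route work under `Spine/NE7b/` by the row OWNER (`t4-ne7b-p1` gen 120, file (132)) under FREEZE
(0)'s crux-prover clause — the distance bookkeeping the locality column (130)–(131) and its coarse sequel consume; NOTHING of Bałaban's
is named as a Lean object, valued or asserted; no `T4Continuum/Support` leaf typed; no `def`, no notation (the distance is WRITTEN OUT
as `Σ_i |valMinAbs (x i − y i)|` at every occurrence); zero `sorry`.  Imports (BY NAME): the OWNER's (89) `…SupTorusDirichletFormCoercive`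
(for the block chart vocabulary `chart`, `windowMap`, `siteOf`, `e` and TDF), the Literature column `B4Sect5Torus` (`IsPseudoDist`,
`SumBound`, `Hyp56`, `Sect5Uniform`, **`sect5Uniform_holds`** — the tree's PROOF of [Balaban1983RegularityDecay] Sect. 5 Theorem over
arbitrary finite index sets), Mathlib's `ZMod.valMinAbs` kit (`natAbs_min_of_le_div_two`, `natAbs_valMinAbs_add_le`, `natAbs_valMinAbs_neg`,
`injective_valMinAbs`), `tsum_geometric_of_lt_one`, `Finset.prod_univ_sum`.

WHY (located).  (131) proves decay of the inverse Hessian in EVERY bond-Lipschitz observable; to read it as KERNEL decay and to pass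
to the coarse torus (the Schur complement `Q′t H⁻¹ Q′t*`, the response, the next-scale Hessian) one needs (a) an actual torus
distance that is bond-Lipschitz, (b) the comparison between the fine distance of two block sites and the coarse distance of their
blocks, (c) period-free lattice sums feeding `B4Sect5Torus.SumBound`, whose `sect5Uniform_holds` then inverts coercive local COARSE
operators with period-free constants.  The road's torus files so far localise «representative-free» through `ℤ^d` weights ((68));
the intrinsic `ℓ¹` circular distance via Mathlib's centred representative `valMinAbs` is the cheapest carrier with all three:
(a) `|valMinAbs(z+1)| = |valMinAbs z| ± 1`; (b) per coordinate, a fine difference `(n+1)D + δ`, `|δ| ≤ n`, over a coarse difference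
`D` has circular size `(n+1)|valMinAbs D| ± n` (minimality of the centred representative on BOTH tori); (c) the `ℓ¹` form factorises,
`Σ_{u ∈ (ℤ∕s)^d} e^{−αΣ_i|u_i|} = (Σ_{m ∈ ℤ∕s} e^{−α|valMinAbs m|})^d ≤ (2∕(1 − e^{−α}))^d` (each sign class of `ℤ∕s` injects into `ℕ`).

WHAT IS PROVED ([folklore] unless marked; `s ≥ 1`, `Site d s = Fin d → ZMod s`; for §3 the fine torus `Site d ((n+1)s)`, `σ = siteOf`,
`wm = windowMap`):
* §1 (one coordinate) `natAbs_valMinAbs_le_of_intCast_eq` (MINIMALITY: `|valMinAbs z| ≤ |m|` for every representative `m`),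
  `natAbs_valMinAbs_add_le'`, `natAbs_valMinAbs_one_le`, `natAbs_valMinAbs_add_one_le` (one bond step moves the size by `≤ 1`),
  **`coord_compare`** (`(n+1)|valMinAbs a| − n ≤ |valMinAbs b| ≤ (n+1)|valMinAbs a| + n` when `D` represents `a : ZMod s` and
  `(n+1)D + δ`, `|δ| ≤ n`, represents `b : ZMod ((n+1)s)`).
* §2 **`isPseudoDist_torus`** (`B4Sect5Torus.IsPseudoDist` of `ρ_s`), `siteOf_e_apply`, **`torusDist_bond_lipschitz`**
  (`|ρ_s(x + ê_μ, y) − ρ_s(x, y)| ≤ 1` — (131)'s observable letter for `ρ_s(·, y)`).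
* §3 `siteOf_chart_apply`, **`fine_coarse_compare`** (`(n+1)ρ_s(y,y′) − dn ≤ ρ_{(n+1)s}(σ(chart n (wm y) z), σ(chart n (wm y′) z′))
  ≤ (n+1)ρ_s(y,y′) + dn`).
* §4 `sum_pow_le_of_injOn`, `sum_zmod_exp_le` (`Σ_{m} e^{−α|valMinAbs m|} ≤ 2(1 − e^{−α})⁻¹`), **`torus_sum_exp_le`**
  (`Σ_{y′} e^{−αρ_s(y,y′)} ≤ (2(1 − e^{−α})⁻¹)^d`, every period), `sumBound_torus` (`B4Sect5Torus.SumBound`).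
* §5 **`coarse_inverse_decay`** (for all `γ₀, c₀, δ₀ > 0` THERE ARE `c₁, δ₁ > 0` such that on EVERY torus `(ℤ∕s)^d` every `T` with
  `B4Sect5Torus.Hyp56 ρ_s T γ₀ c₀ δ₀` — symmetric, `T ≥ γ₀`, `|T(y,y′)| ≤ c₀e^{−δ₀ρ_s}` — has `|T⁻¹(y,y′)| ≤ c₁e^{−δ₁ρ_s(y,y′)}`)
  [cite: Balaban1983RegularityDecay, Sect. 5 Theorem p.594 + p.597] — the tree's proved theorem READ on the torus, nothing new asserted.
* §6 toy.

HONEST (what this is NOT).  Bookkeeping on Mathlib's `ZMod.valMinAbs` and one call of the tree's B4 Sect. 5 proof; the `ℓ¹` (not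
sup) circular distance — equivalent up to the factor `d`, constants not optimised; no operator of the road appears here (the Schur
complement ∕ response ∕ next-scale Hessian are the sequel); cubic periods; scalar skeleton ((A3), NC-NE7b-α UNRULED); nothing of
Bałaban's.  BY-NAME EFFECT ON THE WALL: NONE.  NE7b NOT PRINTED ∕ NOT PROVED; spine PROVED 0∕9; rung (B)+1 on a FINITE torus — NOT
infinite volume, NOT the mass gap, NOT Clay.  HONEST DEPENDENCY: continuum YM on T⁴ ⇐ BetaPertH ∧ nine spine estimates (0∕9 proved);
BetaPertH ⇐ (D1) ∧ (D4) ∧ CAP+tail; G-an2-4 gates asym, D1 and NE2∕3∕4.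
-/

set_option autoImplicit false

noncomputable section

namespace Summit.QuantumFields.BalabanUV.T4Continuum.NE7b.SupTorusBlockDistance

open Real
open Literature.MathematicalPhysics.QuantumFieldTheory.Balaban1983to89
open B6QGQLower276 (X e blk B side chart mem_B sum_B sum_B_const card_cube)
open Beta (Site siteOf windowMap siteOf_windowMap siteOf_add)
open B4Sect5Torus (IsPseudoDist SumBound)

variable {d : ℕ}

/-! ## §1. One coordinate: the circular size `|valMinAbs z|` of a residue `z : ZMod s` -/

section Coordinate

variable {s : ℕ} [NeZero s]

/-- **MINIMALITY**: the centred representative is the shortest one — `|valMinAbs z| ≤ |m|` for every integer `m` representing `z`. [folklore] -/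
theorem natAbs_valMinAbs_le_of_intCast_eq (z : ZMod s) (m : ℤ) (hm : (m : ZMod s) = z) : z.valMinAbs.natAbs ≤ m.natAbs :=
  ZMod.natAbs_min_of_le_div_two s z.valMinAbs m (by rw [ZMod.coe_valMinAbs, hm]) (ZMod.natAbs_valMinAbs_le z)

omit [NeZero s] in
/-- Subadditivity: `|valMinAbs (a + b)| ≤ |valMinAbs a| + |valMinAbs b|`. [folklore] -/
theorem natAbs_valMinAbs_add_le' (a b : ZMod s) : (a + b).valMinAbs.natAbs ≤ a.valMinAbs.natAbs + b.valMinAbs.natAbs :=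
  (ZMod.natAbs_valMinAbs_add_le a b).trans (Int.natAbs_add_le _ _)

/-- `|valMinAbs 1| ≤ 1`. [folklore] -/
theorem natAbs_valMinAbs_one_le : (1 : ZMod s).valMinAbs.natAbs ≤ 1 := by
  have h := natAbs_valMinAbs_le_of_intCast_eq (1 : ZMod s) 1 (by simp)
  simpa using h

/-- One bond step changes the circular size by at most one: `|valMinAbs (z + 1)| ≤ |valMinAbs z| + 1` and
`|valMinAbs z| ≤ |valMinAbs (z + 1)| + 1`. [folklore] -/
theorem natAbs_valMinAbs_add_one_le (z : ZMod s) :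
    (z + 1).valMinAbs.natAbs ≤ z.valMinAbs.natAbs + 1 ∧ z.valMinAbs.natAbs ≤ (z + 1).valMinAbs.natAbs + 1 := by
  constructor
  · exact (natAbs_valMinAbs_add_le' z 1).trans (by have := natAbs_valMinAbs_one_le (s := s); omega)
  · have h := natAbs_valMinAbs_add_le' (z + 1) (-1)
    rw [add_neg_cancel_right, ZMod.natAbs_valMinAbs_neg] at h
    exact h.trans (by have := natAbs_valMinAbs_one_le (s := s); omega)

/-- **FINE VERSUS COARSE, ONE COORDINATE.**  If `D ∈ ℤ` represents the coarse residue `a : ZMod s` and `(n+1)·D + δ` with `|δ| ≤ n`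
represents the fine residue `b : ZMod ((n+1)s)`, then `(n+1)|valMinAbs a| − n ≤ |valMinAbs b| ≤ (n+1)|valMinAbs a| + n` — a fine
coordinate difference inside blocks `D` apart is `(n+1)·(circular size of D)` up to the block side. [folklore] -/
theorem coord_compare (n : ℕ) (D δ : ℤ) (hδ : |δ| ≤ n) (a : ZMod s) (ha : (D : ZMod s) = a) (b : ZMod ((n + 1) * s))
    (hb : ((((n : ℤ) + 1) * D + δ : ℤ) : ZMod ((n + 1) * s)) = b) :
    ((n : ℤ) + 1) * (a.valMinAbs.natAbs : ℤ) - n ≤ (b.valMinAbs.natAbs : ℤ)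
      ∧ (b.valMinAbs.natAbs : ℤ) ≤ ((n : ℤ) + 1) * (a.valMinAbs.natAbs : ℤ) + n := by
  have hN : (((n + 1) * s : ℕ) : ℤ) = ((n : ℤ) + 1) * s := by push_cast; ring
  constructor
  · -- lower: the centred representative `m₀` of `b` is `(n+1)(D − s k) + δ` for some `k`, and `D − s k` represents `a`
    set m₀ := b.valMinAbs with hm₀
    have h1 : ((m₀ : ℤ) : ZMod ((n + 1) * s)) = ((((n : ℤ) + 1) * D + δ : ℤ) : ZMod ((n + 1) * s)) := by
      rw [hb, hm₀, ZMod.coe_valMinAbs]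
    obtain ⟨k, hk⟩ := (ZMod.intCast_eq_intCast_iff_dvd_sub _ _ _).1 h1
    rw [hN] at hk
    have hrep : ((D - s * k : ℤ) : ZMod s) = a := by
      rw [← ha, ZMod.intCast_eq_intCast_iff_dvd_sub]
      exact ⟨k, by ring⟩
    have hmin := natAbs_valMinAbs_le_of_intCast_eq a (D - s * k) hrep
    have hm₀eq : m₀ = ((n : ℤ) + 1) * (D - s * k) + δ := by linear_combination (-1 : ℤ) * hk
    have e1 : (((D - s * k).natAbs : ℕ) : ℤ) = |D - s * k| := Int.natCast_natAbs _
    have e2 : ((m₀.natAbs : ℕ) : ℤ) = |m₀| := Int.natCast_natAbs _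
    have hmin' : (a.valMinAbs.natAbs : ℤ) ≤ |D - s * k| := by rw [← e1]; exact_mod_cast hmin
    have htri : ((n : ℤ) + 1) * |D - s * k| - |δ| ≤ |m₀| := by
      rw [hm₀eq]
      have := abs_add_le (((n : ℤ) + 1) * (D - s * k) + δ) (-δ)
      rw [add_neg_cancel_right, abs_mul, abs_neg, abs_of_nonneg (by positivity : (0 : ℤ) ≤ (n : ℤ) + 1)] at this
      linarith
    rw [e2]
    nlinarith
  · -- upper: `(n+1)·valMinAbs a + δ` represents `b`
    set v := a.valMinAbs with hv
    have h1 : ((D : ℤ) : ZMod s) = ((v : ℤ) : ZMod s) := by rw [ha, hv, ZMod.coe_valMinAbs]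
    obtain ⟨k, hk⟩ := (ZMod.intCast_eq_intCast_iff_dvd_sub _ _ _).1 h1
    have hrep : (((((n : ℤ) + 1) * v + δ : ℤ)) : ZMod ((n + 1) * s)) = b := by
      rw [← hb, ZMod.intCast_eq_intCast_iff_dvd_sub, hN]
      exact ⟨-k, by linear_combination (-((n : ℤ) + 1)) * hk⟩
    have hmin := natAbs_valMinAbs_le_of_intCast_eq b _ hrep
    have e1 : (((((n : ℤ) + 1) * v + δ).natAbs : ℕ) : ℤ) = |((n : ℤ) + 1) * v + δ| := Int.natCast_natAbs _
    have e2 : ((v.natAbs : ℕ) : ℤ) = |v| := Int.natCast_natAbs _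
    have hmin' : (b.valMinAbs.natAbs : ℤ) ≤ |((n : ℤ) + 1) * v + δ| := by rw [← e1]; exact_mod_cast hmin
    have htri : |((n : ℤ) + 1) * v + δ| ≤ ((n : ℤ) + 1) * |v| + |δ| := by
      calc |((n : ℤ) + 1) * v + δ| ≤ |((n : ℤ) + 1) * v| + |δ| := abs_add_le _ _
        _ = ((n : ℤ) + 1) * |v| + |δ| := by rw [abs_mul, abs_of_nonneg (by positivity : (0 : ℤ) ≤ (n : ℤ) + 1)]
    rw [e2]
    linarith

end Coordinate

/-! ## §2. The `ℓ¹` circular distance of a torus `(ℤ∕s)^d = Site d s`: a pseudo-distance, bond-Lipschitz -/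

section Distance

variable (s : ℕ) [NeZero s]

omit [NeZero s] in
/-- **THE `ℓ¹` CIRCULAR DISTANCE IS A PSEUDO-DISTANCE** (`ρ_s(x,y) := Σ_i |valMinAbs (x i − y i)|`, in the vocabulary of
`B4Sect5Torus`): zero on the diagonal, symmetric, triangle inequality. [folklore] -/
theorem isPseudoDist_torus : IsPseudoDist (fun x y : Site d s => ∑ i, (((x i - y i).valMinAbs.natAbs : ℕ) : ℝ)) where
  symm x y := Finset.sum_congr rfl fun i _ => by rw [← neg_sub (x i) (y i), ZMod.natAbs_valMinAbs_neg]
  zero x := by simp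
  triangle x y z := by
    rw [← Finset.sum_add_distrib]
    refine Finset.sum_le_sum fun i _ => ?_
    have h := natAbs_valMinAbs_add_le' (x i - y i) (y i - z i)
    rw [sub_add_sub_cancel] at h
    exact_mod_cast h

omit [NeZero s] in
/-- The torus unit vector has one nonzero coordinate: `(siteOf (e μ)) i = if i = μ then 1 else 0`. [folklore] -/
theorem siteOf_e_apply (μ i : Fin d) : siteOf d s (e μ) i = if i = μ then 1 else 0 := by
  by_cases h : i = μ
  · subst h; simp [siteOf, B6QGQLower276.e_apply_self]
  · simp [siteOf, B6QGQLower276.e_apply_ne h, h]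

/-- **THE `ℓ¹` CIRCULAR DISTANCE TO ANY SITE IS BOND-LIPSCHITZ** ((131)'s observable letter): `|ρ_s(x + ê_μ, y) − ρ_s(x, y)| ≤ 1`.
[folklore] -/
theorem torusDist_bond_lipschitz (x y : Site d s) (μ : Fin d) :
    |(∑ i, ((((x + siteOf d s (e μ)) i - y i).valMinAbs.natAbs : ℕ) : ℝ)) - ∑ i, (((x i - y i).valMinAbs.natAbs : ℕ) : ℝ)| ≤ 1 := by
  rw [← Finset.sum_sub_distrib, Finset.sum_eq_single μ (fun i _ hi => by
      rw [Pi.add_apply, siteOf_e_apply, if_neg hi, add_zero, sub_self]) (fun h => (h (Finset.mem_univ μ)).elim),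
    Pi.add_apply, siteOf_e_apply, if_pos rfl, show x μ + 1 - y μ = (x μ - y μ) + 1 by ring]
  have h := natAbs_valMinAbs_add_one_le (x μ - y μ)
  rw [abs_le]
  constructor
  · have h2 : ((x μ - y μ).valMinAbs.natAbs : ℝ) ≤ ((x μ - y μ + 1).valMinAbs.natAbs : ℝ) + 1 := by exact_mod_cast h.2
    linarith
  · have h1 : ((x μ - y μ + 1).valMinAbs.natAbs : ℝ) ≤ ((x μ - y μ).valMinAbs.natAbs : ℝ) + 1 := by exact_mod_cast h.1
    linarith

end Distance

/-! ## §3. Fine versus coarse: sites of blocks `y`, `y′` are `(n+1)·ρ_s(y,y′) ± dn` apart on the fine torus -/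

section Blocks

variable (n s : ℕ) [NeZero s]

/-- A coordinate of a block site on the fine torus: `σ_N(chart n (wm y) z) i = ((n+1)·(wm y) i + z i : ℤ) mod N`. [folklore] -/
theorem siteOf_chart_apply (y : Site d s) (z : Fin d → Fin (n + 1)) (i : Fin d) :
    siteOf d ((n + 1) * s) (chart n (windowMap d s y) z) i = ((((n : ℤ) + 1) * windowMap d s y i + ((z i : ℕ) : ℤ) : ℤ) : ZMod ((n + 1) * s)) := by
  simp [siteOf, chart, side]

/-- **FINE VERSUS COARSE**: for `x = σ(chart n (wm y) z)`, `x′ = σ(chart n (wm y′) z′)` on the fine torus `(ℤ∕(n+1)s)^d`,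
`(n+1)·ρ_s(y, y′) − d·n ≤ ρ_{(n+1)s}(x, x′) ≤ (n+1)·ρ_s(y, y′) + d·n`. [folklore] -/
theorem fine_coarse_compare (y y' : Site d s) (z z' : Fin d → Fin (n + 1)) :
    ((n : ℝ) + 1) * (∑ i, (((y i - y' i).valMinAbs.natAbs : ℕ) : ℝ)) - d * n
        ≤ ∑ i, ((((siteOf d ((n + 1) * s) (chart n (windowMap d s y) z)) i
              - (siteOf d ((n + 1) * s) (chart n (windowMap d s y') z')) i).valMinAbs.natAbs : ℕ) : ℝ)
      ∧ ∑ i, ((((siteOf d ((n + 1) * s) (chart n (windowMap d s y) z)) i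
              - (siteOf d ((n + 1) * s) (chart n (windowMap d s y') z')) i).valMinAbs.natAbs : ℕ) : ℝ)
        ≤ ((n : ℝ) + 1) * (∑ i, (((y i - y' i).valMinAbs.natAbs : ℕ) : ℝ)) + d * n := by
  have hcoord : ∀ i : Fin d,
      ((n : ℤ) + 1) * ((y i - y' i).valMinAbs.natAbs : ℤ) - n
          ≤ (((siteOf d ((n + 1) * s) (chart n (windowMap d s y) z)) i
              - (siteOf d ((n + 1) * s) (chart n (windowMap d s y') z')) i).valMinAbs.natAbs : ℤ)
        ∧ (((siteOf d ((n + 1) * s) (chart n (windowMap d s y) z)) i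
              - (siteOf d ((n + 1) * s) (chart n (windowMap d s y') z')) i).valMinAbs.natAbs : ℤ)
          ≤ ((n : ℤ) + 1) * ((y i - y' i).valMinAbs.natAbs : ℤ) + n := by
    intro i
    refine coord_compare n (windowMap d s y i - windowMap d s y' i) (((z i : ℕ) : ℤ) - ((z' i : ℕ) : ℤ)) ?_ (y i - y' i) ?_ _ ?_
    · rw [abs_le]; constructor <;> · have := Fin.is_le (z i); have := Fin.is_le (z' i); omega
    · have hy := congrFun (siteOf_windowMap d s y) i
      have hy' := congrFun (siteOf_windowMap d s y') i
      simp only [siteOf] at hy hy'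
      push_cast
      rw [hy, hy']
    · rw [siteOf_chart_apply, siteOf_chart_apply]
      push_cast
      ring
  -- cast the integer letters to `ℝ`
  have hreal : ∀ i : Fin d,
      ((n : ℝ) + 1) * (((y i - y' i).valMinAbs.natAbs : ℕ) : ℝ) - n
          ≤ ((((siteOf d ((n + 1) * s) (chart n (windowMap d s y) z)) i
              - (siteOf d ((n + 1) * s) (chart n (windowMap d s y') z')) i).valMinAbs.natAbs : ℕ) : ℝ)
        ∧ ((((siteOf d ((n + 1) * s) (chart n (windowMap d s y) z)) i
              - (siteOf d ((n + 1) * s) (chart n (windowMap d s y') z')) i).valMinAbs.natAbs : ℕ) : ℝ)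
          ≤ ((n : ℝ) + 1) * (((y i - y' i).valMinAbs.natAbs : ℕ) : ℝ) + n := by
    intro i
    obtain ⟨h1, h2⟩ := hcoord i
    have h1' := (Int.cast_le (R := ℝ)).2 h1
    have h2' := (Int.cast_le (R := ℝ)).2 h2
    push_cast at h1' h2'
    simp only [Nat.cast_natAbs, Int.cast_abs]
    exact ⟨h1', h2'⟩
  constructor
  · have h : ∑ i : Fin d, (((n : ℝ) + 1) * (((y i - y' i).valMinAbs.natAbs : ℕ) : ℝ) - n)
        ≤ ∑ i, ((((siteOf d ((n + 1) * s) (chart n (windowMap d s y) z)) i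
              - (siteOf d ((n + 1) * s) (chart n (windowMap d s y') z')) i).valMinAbs.natAbs : ℕ) : ℝ) :=
      Finset.sum_le_sum fun i _ => (hreal i).1
    rw [Finset.sum_sub_distrib, ← Finset.mul_sum, Finset.sum_const, Finset.card_univ, Fintype.card_fin, nsmul_eq_mul] at h
    exact h
  · have h : ∑ i, ((((siteOf d ((n + 1) * s) (chart n (windowMap d s y) z)) i
              - (siteOf d ((n + 1) * s) (chart n (windowMap d s y') z')) i).valMinAbs.natAbs : ℕ) : ℝ)
        ≤ ∑ i : Fin d, (((n : ℝ) + 1) * (((y i - y' i).valMinAbs.natAbs : ℕ) : ℝ) + n) :=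
      Finset.sum_le_sum fun i _ => (hreal i).2
    rw [Finset.sum_add_distrib, ← Finset.mul_sum, Finset.sum_const, Finset.card_univ, Fintype.card_fin, nsmul_eq_mul] at h
    exact h

end Blocks

/-! ## §4. Lattice sums on the torus, uniformly in the period: the profile `(2∕(1 − e^{−α}))^d` -/

section Sums

variable (s : ℕ) [NeZero s]

/-- A sum of powers `r^{φ m}` over a set on which `φ` is injective is at most the geometric series `(1 − r)⁻¹`. [folklore] -/
theorem sum_pow_le_of_injOn {ι : Type*} [DecidableEq ι] (S : Finset ι) (φ : ι → ℕ) (hφ : Set.InjOn φ S) {r : ℝ} (hr0 : 0 ≤ r)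
    (hr1 : r < 1) : ∑ m ∈ S, r ^ φ m ≤ (1 - r)⁻¹ := by
  have h : ∑ k ∈ S.image φ, r ^ k = ∑ m ∈ S, r ^ φ m := Finset.sum_image (f := fun k : ℕ => r ^ k) hφ
  rw [← h, ← tsum_geometric_of_lt_one hr0 hr1]
  exact (summable_geometric_of_lt_one hr0 hr1).sum_le_tsum _ fun _ _ => pow_nonneg hr0 _

/-- **ONE COORDINATE**: `Σ_{m ∈ ℤ∕s} e^{−α|valMinAbs m|} ≤ 2(1 − e^{−α})⁻¹`, every period `s` (the centred representative is injective,
so each sign class injects into `ℕ`). [folklore] -/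
theorem sum_zmod_exp_le {α : ℝ} (hα : 0 < α) :
    ∑ m : ZMod s, exp (-(α * ((m.valMinAbs.natAbs : ℕ) : ℝ))) ≤ 2 * (1 - exp (-α))⁻¹ := by
  classical
  set r := exp (-α) with hr
  have hr0 : 0 ≤ r := (exp_pos _).le
  have hr1 : r < 1 := exp_lt_one_iff.2 (by linarith)
  have hterm : ∀ m : ZMod s, exp (-(α * ((m.valMinAbs.natAbs : ℕ) : ℝ))) = r ^ m.valMinAbs.natAbs := fun m => by
    rw [hr, ← Real.exp_nat_mul]; ring_nf
  simp only [hterm]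
  rw [← Finset.sum_filter_add_sum_filter_not Finset.univ (fun m : ZMod s => 0 ≤ m.valMinAbs)]
  have hinj : Function.Injective (ZMod.valMinAbs : ZMod s → ℤ) := ZMod.injective_valMinAbs
  have h1 : ∑ m ∈ Finset.univ.filter (fun m : ZMod s => 0 ≤ m.valMinAbs), r ^ m.valMinAbs.natAbs ≤ (1 - r)⁻¹ := by
    refine sum_pow_le_of_injOn _ _ (fun m hm m' hm' h => hinj ?_) hr0 hr1
    have hm0 : 0 ≤ m.valMinAbs := (Finset.mem_filter.1 hm).2
    have hm0' : 0 ≤ m'.valMinAbs := (Finset.mem_filter.1 hm').2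
    have := Int.natAbs_inj_of_nonneg_of_nonneg hm0 hm0'
    exact this.1 h
  have h2 : ∑ m ∈ Finset.univ.filter (fun m : ZMod s => ¬ 0 ≤ m.valMinAbs), r ^ m.valMinAbs.natAbs ≤ (1 - r)⁻¹ := by
    refine sum_pow_le_of_injOn _ _ (fun m hm m' hm' h => hinj ?_) hr0 hr1
    have hm0 : m.valMinAbs ≤ 0 := (not_le.1 (Finset.mem_filter.1 hm).2).le
    have hm0' : m'.valMinAbs ≤ 0 := (not_le.1 (Finset.mem_filter.1 hm').2).le
    have := Int.natAbs_inj_of_nonpos_of_nonpos hm0 hm0'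
    exact this.1 h
  linarith

/-- **THE TORUS LATTICE SUMS ARE BOUNDED UNIFORMLY IN THE PERIOD**: `Σ_{y′} e^{−α·ρ_s(y, y′)} ≤ (2(1 − e^{−α})⁻¹)^d` for every `α > 0`,
every centre `y`, every period `s` — the `ℓ¹` distance factorises over the coordinates. [folklore] -/
theorem torus_sum_exp_le {α : ℝ} (hα : 0 < α) (y : Site d s) :
    ∑ y' : Site d s, exp (-(α * ∑ i, (((y i - y' i).valMinAbs.natAbs : ℕ) : ℝ))) ≤ (2 * (1 - exp (-α))⁻¹) ^ d := by
  classical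
  -- reindex by `u = y − y′`, factorise the exponential, exchange sum and product
  have h1 : ∑ y' : Site d s, exp (-(α * ∑ i, (((y i - y' i).valMinAbs.natAbs : ℕ) : ℝ)))
      = ∑ u : Site d s, exp (-(α * ∑ i, (((u i).valMinAbs.natAbs : ℕ) : ℝ))) :=
    (Equiv.subLeft y).sum_comp (fun u : Site d s => exp (-(α * ∑ i, (((u i).valMinAbs.natAbs : ℕ) : ℝ))))
  have h2 : ∀ u : Site d s, exp (-(α * ∑ i, (((u i).valMinAbs.natAbs : ℕ) : ℝ)))
      = ∏ i, exp (-(α * (((u i).valMinAbs.natAbs : ℕ) : ℝ))) := fun u => by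
    rw [Finset.mul_sum, ← Real.exp_sum, ← Finset.sum_neg_distrib]
  have h3 : ∑ u : Site d s, ∏ i, exp (-(α * (((u i).valMinAbs.natAbs : ℕ) : ℝ)))
      = ∏ _i : Fin d, ∑ m : ZMod s, exp (-(α * ((m.valMinAbs.natAbs : ℕ) : ℝ))) := by
    rw [Finset.prod_univ_sum (fun _ : Fin d => (Finset.univ : Finset (ZMod s)))
      (fun _ m => exp (-(α * ((m.valMinAbs.natAbs : ℕ) : ℝ)))), Fintype.piFinset_univ]
  rw [h1, Finset.sum_congr rfl fun u _ => h2 u, h3, Finset.prod_const, Finset.card_univ, Fintype.card_fin]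
  exact pow_le_pow_left₀ (Finset.sum_nonneg fun _ _ => (exp_pos _).le) (sum_zmod_exp_le s hα) d

/-- The same as a `B4Sect5Torus.SumBound` profile for the `ℓ¹` circular distance. [folklore] -/
theorem sumBound_torus :
    SumBound (fun x y : Site d s => ∑ i, (((x i - y i).valMinAbs.natAbs : ℕ) : ℝ)) (fun α => (2 * (1 - exp (-α))⁻¹) ^ d) :=
  fun _ hα y => torus_sum_exp_le s hα y

end Sums

/-! ## §5. The coarse inverse: B4's Sect. 5 Theorem BY NAME on every torus `(ℤ∕s)^d` -/

/-- **A COERCIVE, EXPONENTIALLY LOCAL OPERATOR ON A TORUS HAS AN EXPONENTIALLY LOCAL INVERSE, UNIFORMLY IN THE PERIOD**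
(`B4Sect5Torus.sect5Uniform_holds` at the `ℓ¹` circular distance and the profile of §4): for all positive `γ₀, c₀, δ₀` THERE ARE
positive `c₁, δ₁` (functions of `γ₀, c₀, δ₀, d` only) such that on EVERY torus `(ℤ∕s)^d`, every symmetric `T` with `T ≥ γ₀` and
`|T(y,y′)| ≤ c₀e^{−δ₀ρ_s(y,y′)}` has `|T⁻¹(y,y′)| ≤ c₁e^{−δ₁ρ_s(y,y′)}`.  [cite: Balaban1983RegularityDecay, Sect. 5 Theorem p.594 + p.597]
(the tree's PROVED theorem, read on the torus — nothing new asserted). -/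
theorem coarse_inverse_decay {γ₀ c₀ δ₀ : ℝ} (hγ : 0 < γ₀) (hc : 0 < c₀) (hδ : 0 < δ₀) :
    ∃ c₁ δ₁ : ℝ, 0 < c₁ ∧ 0 < δ₁ ∧ ∀ (s : ℕ) [NeZero s] (T : Matrix (Site d s) (Site d s) ℝ),
      B4Sect5Torus.Hyp56 (fun x y : Site d s => ∑ i, (((x i - y i).valMinAbs.natAbs : ℕ) : ℝ)) T γ₀ c₀ δ₀ →
      ∀ y y' : Site d s, |T⁻¹ y y'| ≤ c₁ * exp (-(δ₁ * ∑ i, (((y i - y' i).valMinAbs.natAbs : ℕ) : ℝ))) := by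
  have hK : ∀ α : ℝ, 0 < α → 0 ≤ (2 * (1 - exp (-α))⁻¹) ^ d := fun α hα =>
    pow_nonneg (mul_nonneg zero_le_two (inv_nonneg.2 (sub_nonneg.2 (exp_le_one_iff.2 (by linarith))))) d
  obtain ⟨c₁, δ₁, hc₁, hδ₁, H⟩ :=
    B4Sect5Torus.sect5Uniform_holds (fun α => (2 * (1 - exp (-α))⁻¹) ^ d) hK γ₀ c₀ δ₀ hγ hc hδ
  refine ⟨c₁, δ₁, hc₁, hδ₁, fun s _ T hT y y' => ?_⟩
  classical
  have h := (H (Site d s) _ (isPseudoDist_torus s) (sumBound_torus s) T hT (Site d s) id Function.injective_id).1 y y'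
  simpa only [Matrix.submatrix_id_id, id] using h

/-! ## §6. Toy -/

/-- Toy: on the torus `(ℤ∕3)²` the `ℓ¹` circular distance between `(0,0)` and `(2,1)` is `|valMinAbs 2| + |valMinAbs 1| = 1 + 1`
(mod 3, `2 ≡ −1`). -/
example : ((((0 : ZMod 3) - 2).valMinAbs.natAbs : ℕ) : ℝ) + ((((0 : ZMod 3) - 1).valMinAbs.natAbs : ℕ) : ℝ) = 1 + 1 := by
  have h1 : ((0 : ZMod 3) - 2).valMinAbs.natAbs = 1 := by decide
  have h2 : ((0 : ZMod 3) - 1).valMinAbs.natAbs = 1 := by decide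
  rw [h1, h2]; norm_num

/-- Toy: the distance vanishes on the diagonal of every torus (`isPseudoDist_torus`). -/
example (s : ℕ) (x : Site 2 s) : ∑ i, (((x i - x i).valMinAbs.natAbs : ℕ) : ℝ) = 0 := (isPseudoDist_torus (d := 2) s).zero x

end Summit.QuantumFields.BalabanUV.T4Continuum.NE7b.SupTorusBlockDistance
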